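import Mathlib.Algebra.Polynomial.Identities
import Mathlib.Algebra.Polynomial.Div
import Mathlib.Algebra.Polynomial.Derivative
import Mathlib.RingTheory.Polynomial.Vieta
import Mathlib.RingTheory.MvPolynomial.Homogeneous
import Mathlib.RingTheory.MvPolynomial.Ideal
import Mathlib.RingTheory.Ideal.Quotient.Operations
import Mathlib.RingTheory.Nilpotent.Basic
import Literature.RingTheory.MvPolynomial.IdealOfVarsBasics
import HarnessLib

/-!
# Vieta's formulas from APPROXIMATE roots, and the root-free Newton (chord) iteration

Topic `Computability/AlgebraicComplexity`; namespace `Literature.Computability.AlgebraicComplexity`.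
Theorem-only toolkit (no definitions, no named facts) for the discharge of the named fact
`BlaserJindal2019_thm4` (Bläser–Jindal, ITCS 2019, Thm. 4: the witness `f` of a symmetric polynomial
`f_Sym = f(e_1, …, e_n)` has circuits of size polynomial in `L(f_Sym)`, `deg f_Sym`, `n`), file
`BlaserJindalSymmetricProofs.lean`. The printed proof (§4 of the paper) computes the POWER-SERIES
roots of `B(y) = Π_i (y - x_i)` by Newton iteration; power-series roots are not polynomials, so the
tree's polynomial Newton lemma `newton_iterate_vanish` (`RootLifting.lean`, which needs an actual
polynomial root) does not apply verbatim. This file supplies the two root-free replacements: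

* §1 **Monic polynomials in Vieta form.** For `c : Fin n → S`, the polynomial
  `X^n + Σ_i C(c_i) X^{n-1-i}` is monic of degree `n` with `(n-1-i)`-th coefficient `c_i`
  (`coeff_X_pow_add_sum_C_mul_X_pow`), and `Π_i (X - C r_i)` has this form with
  `c_i = (-1)^{i+1} e_{i+1}(r)` (`prod_X_sub_C_eq_X_pow_add_sum`, Mathlib's multiset Vieta
  `Multiset.prod_X_sub_X_eq_sum_esymm` re-indexed by `Fin n`).
* §1 **The factor theorem with unit root differences** (`eq_prod_X_sub_C_of_eval_eq_zero`): over ANY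
  commutative ring, a monic polynomial of degree `|s|` vanishing at points `r_i` (`i ∈ s`) whose
  pairwise differences are units is `Π_{i ∈ s} (X - C r_i)`. Applied in the Artinian quotient
  `F[z] ⧸ ⟨z⟩^N`, where an element with nonzero constant term is a unit
  (the tree's `isUnit_mk_idealOfVars_pow_of_isUnit_constantCoeff`), this turns `n` APPROXIMATE roots with distinct constant terms into
  Vieta's formulas modulo `⟨z⟩^N`.
* §2 **Order ideals.** Mathlib's `MvPolynomial.idealOfVars β R ^ N` is the ideal of polynomials
  vanishing to order `N`; the dictionary with homogeneous components
  (`mem_pow_idealOfVars_iff_homogeneousComponent`); constant terms and units modulo `⟨x⟩^N` are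
  the tree's `Literature/RingTheory/MvPolynomial/IdealOfVarsBasics.lean` (cited, not restated).
* §3 **The root-free Newton invariant** (`newton_iterate_constantCoeff`, `newton_iterate_eval_mem`):
  for `φ ∈ F[z][y]`, a scalar `c₀` with `φ(0, c₀) = 0` and `ξ := ∂_y φ(0, c₀) ≠ 0`, the chord
  iterates `z_0 = c₀`, `z_{r+1} = z_r - ξ⁻¹ φ(z_r)` keep the constant term `c₀` and satisfy
  `φ(z_r) ∈ ⟨z⟩^{r+1}` — first-order Taylor expansion (`Polynomial.binomExpansion`), exactly the
  computation of `RootLifting.newton_iterate_vanish` with "`z_r - g`" replaced by "`φ(z_r)`".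
  The tree's cost bound `complexity_newton_iterate_le` (`RootLifting.lean`) applies to these
  iterates unchanged.

References: M. Bläser, G. Jindal, *On the Complexity of Symmetric Polynomials*, ITCS 2019,
LIPIcs 124, 47:1–47:14, §4 [BlaserJindal2019]; Z. Dvir, A. Shpilka, A. Yehudayoff, SIAM J. Comput.
39 (2009), Lemma 3.1 (Newton iteration with linear convergence) [DvirShpilkaYehudayoff2009];
P. Dutta, N. Saxena, A. Sinhababu, STOC 2018, §1.3 ("slow Newton iteration")
[DuttaSaxenaSinhababu2018]. Honest framing: elementary commutative algebra; nothing here bears on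
VP versus VNP.
-/

noncomputable section

namespace Literature.Computability.AlgebraicComplexity

open Finset

/-! ### §1 Monic polynomials in Vieta form; the factor theorem with unit root differences -/

section VietaForm

open Polynomial

variable {S : Type*} [CommRing S]

/-- Coefficient extraction for the Vieta form: the coefficient of `X^{n-1-i}` in
`X^n + Σ_j C(c_j) X^{n-1-j}` is `c_i`. [cite: Lang2002, Ch. IV §6 (elementary symmetric polynomials: Π(X − tᵢ) = Xⁿ − s₁Xⁿ⁻¹ + ⋯ ± sₙ)] -/
theorem coeff_X_pow_add_sum_C_mul_X_pow {n : ℕ} (c : Fin n → S) (i : Fin n) :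
    (X ^ n + ∑ j : Fin n, C (c j) * X ^ (n - 1 - (j : ℕ)) : S[X]).coeff (n - 1 - (i : ℕ)) = c i := by
  have hi := i.isLt
  rw [coeff_add, coeff_X_pow, if_neg (by omega), zero_add, finsetSum_coeff]
  simp_rw [coeff_C_mul_X_pow]
  rw [Finset.sum_eq_single i (fun j _ hji => ?_) (fun h => absurd (mem_univ i) h), if_pos rfl]
  rw [if_neg]
  intro h
  apply hji
  have hj := j.isLt
  exact Fin.ext (by omega)

/-- The Vieta form has degree `< n` below the leading term.
[cite: Lang2002, Ch. IV §6 (elementary symmetric polynomials: Π(X − tᵢ) = Xⁿ − s₁Xⁿ⁻¹ + ⋯ ± sₙ)] -/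
theorem degree_sum_C_mul_X_pow_lt {n : ℕ} (c : Fin n → S) :
    (∑ j : Fin n, C (c j) * X ^ (n - 1 - (j : ℕ)) : S[X]).degree < n := by
  rcases Nat.eq_zero_or_pos n with rfl | hn
  · simp
  refine (degree_sum_le _ _).trans_lt ?_
  refine (Finset.sup_lt_iff (WithBot.bot_lt_coe n)).2 fun j _ => ?_
  refine (degree_C_mul_X_pow_le _ _).trans_lt ?_
  have hj := j.isLt
  obtain ⟨k, hk, hkn⟩ : ∃ k, n - 1 - (j : ℕ) = k ∧ k < n := ⟨_, rfl, by omega⟩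
  rw [hk]
  exact WithBot.coe_lt_coe.2 hkn

/-- The Vieta form `X^n + Σ_j C(c_j) X^{n-1-j}` is monic.
[cite: Lang2002, Ch. IV §6 (elementary symmetric polynomials: Π(X − tᵢ) = Xⁿ − s₁Xⁿ⁻¹ + ⋯ ± sₙ)] -/
theorem monic_X_pow_add_sum_C_mul_X_pow {n : ℕ} (c : Fin n → S) :
    (X ^ n + ∑ j : Fin n, C (c j) * X ^ (n - 1 - (j : ℕ)) : S[X]).Monic :=
  monic_X_pow_add (degree_sum_C_mul_X_pow_lt c)

/-- The Vieta form `X^n + Σ_j C(c_j) X^{n-1-j}` has degree exactly `n` over a nontrivial ring.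
[cite: Lang2002, Ch. IV §6 (elementary symmetric polynomials: Π(X − tᵢ) = Xⁿ − s₁Xⁿ⁻¹ + ⋯ ± sₙ)] -/
theorem natDegree_X_pow_add_sum_C_mul_X_pow [Nontrivial S] {n : ℕ} (c : Fin n → S) :
    (X ^ n + ∑ j : Fin n, C (c j) * X ^ (n - 1 - (j : ℕ)) : S[X]).natDegree = n := by
  rw [natDegree_add_eq_left_of_degree_lt, natDegree_X_pow]
  rw [degree_X_pow]
  exact degree_sum_C_mul_X_pow_lt c

/-- **Vieta's formulas, `Fin n`-indexed Vieta form**: `Π_i (X - C r_i) = X^n + Σ_i C((-1)^{i+1}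
e_{i+1}(r)) X^{n-1-i}` with `e_k(r)` the `k`-th elementary symmetric function of the multiset of
values (Mathlib's `Multiset.prod_X_sub_X_eq_sum_esymm`, re-indexed).
[cite: Lang2002, Ch. IV §6 (elementary symmetric polynomials: Π(X − tᵢ) = Xⁿ − s₁Xⁿ⁻¹ + ⋯ ± sₙ)] -/
theorem prod_X_sub_C_eq_X_pow_add_sum {n : ℕ} (r : Fin n → S) :
    ∏ i : Fin n, (X - C (r i)) =
      X ^ n + ∑ j : Fin n, C ((-1) ^ ((j : ℕ) + 1) * ((univ : Finset (Fin n)).val.map r).esymm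
        ((j : ℕ) + 1)) * X ^ (n - 1 - (j : ℕ)) := by
  have hcard : Multiset.card ((univ : Finset (Fin n)).val.map r) = n := by
    rw [Multiset.card_map, Finset.card_val, Finset.card_univ, Fintype.card_fin]
  have h := Multiset.prod_X_sub_X_eq_sum_esymm ((univ : Finset (Fin n)).val.map r)
  rw [Multiset.map_map, hcard] at h
  have hlhs : ∏ i : Fin n, (X - C (r i)) =
      (((univ : Finset (Fin n)).val.map r).map fun t => X - C t).prod := by
    rw [Multiset.map_map, Finset.prod_eq_multiset_prod]
    rfl
  rw [Finset.prod_eq_multiset_prod]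
  have h' : (Multiset.map (fun i => X - C (r i)) (univ : Finset (Fin n)).val) =
      Multiset.map ((fun t => X - C t) ∘ r) (univ : Finset (Fin n)).val := rfl
  rw [h', h, Finset.sum_range_succ', pow_zero, one_mul, Multiset.esymm, Multiset.powersetCard_zero_left,
    Multiset.map_singleton, Multiset.prod_zero, Multiset.sum_singleton, C_1, one_mul, Nat.sub_zero,
    add_comm, ← Fin.sum_univ_eq_sum_range]
  congr 1
  refine Finset.sum_congr rfl fun j _ => ?_
  rw [C_mul, ← mul_assoc, show n - ((j : ℕ) + 1) = n - 1 - (j : ℕ) by omega]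
  congr 1
  rw [map_pow, map_neg, C_1]

/-- **Factor theorem with unit root differences** (any commutative ring): a monic polynomial of
degree `|s|` vanishing at points `r_i`, `i ∈ s`, whose pairwise differences are units, is
`Π_{i ∈ s} (X - C r_i)`. (Induction: `p = (X - C r_a) q` by `Polynomial.mul_divByMonic_eq_iff_isRoot`,
and `0 = p(r_i) = (r_i - r_a) q(r_i)` forces `q(r_i) = 0` because `r_i - r_a` is a unit; the
classical root-counting argument with "nonzero in a domain" replaced by "unit".)
[cite: Lang2002, Ch. IV §1 (Thm. 1.4: roots and linear factors of a polynomial over a commutative ring)] -/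
theorem eq_prod_X_sub_C_of_eval_eq_zero {ι : Type*} [DecidableEq ι] (r : ι → S) (s : Finset ι)
    (hunit : ∀ i ∈ s, ∀ j ∈ s, i ≠ j → IsUnit (r i - r j)) (p : S[X]) (hmonic : p.Monic)
    (hdeg : p.natDegree = s.card) (hroot : ∀ i ∈ s, p.eval (r i) = 0) :
    p = ∏ i ∈ s, (X - C (r i)) := by
  rcases subsingleton_or_nontrivial S with hS | hS
  · exact Subsingleton.elim _ _
  induction s using Finset.induction_on generalizing p with
  | empty =>
    rw [Finset.prod_empty]
    rw [Finset.card_empty] at hdeg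
    exact (Polynomial.Monic.natDegree_eq_zero hmonic).1 hdeg
  | insert a s ha ih =>
    have hfac : (X - C (r a)) * (p /ₘ (X - C (r a))) = p :=
      mul_divByMonic_eq_iff_isRoot.2 (hroot a (Finset.mem_insert_self a s))
    set q := p /ₘ (X - C (r a)) with hq
    have hqmonic : q.Monic := (monic_X_sub_C (r a)).of_mul_monic_left (by rwa [hfac])
    have hqdeg : q.natDegree = s.card := by
      have h1 := (monic_X_sub_C (r a)).natDegree_mul hqmonic
      rw [hfac, hdeg, Finset.card_insert_of_notMem ha, natDegree_X_sub_C] at h1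
      omega
    have hqroot : ∀ i ∈ s, q.eval (r i) = 0 := by
      intro i hi
      have hia : i ≠ a := fun h => ha (h ▸ hi)
      have h0 := hroot i (Finset.mem_insert_of_mem hi)
      rw [← hfac, eval_mul, eval_sub, eval_X, eval_C] at h0
      exact ((hunit i (Finset.mem_insert_of_mem hi) a (Finset.mem_insert_self a s) hia)
        |>.mul_right_eq_zero).1 h0
    have hunit' : ∀ i ∈ s, ∀ j ∈ s, i ≠ j → IsUnit (r i - r j) := fun i hi j hj hij =>
      hunit i (Finset.mem_insert_of_mem hi) j (Finset.mem_insert_of_mem hj) hij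
    rw [Finset.prod_insert ha, ← ih hunit' q hqmonic hqdeg hqroot, hfac]

end VietaForm

/-! ### §2 Order ideals `⟨x⟩^N` of a polynomial ring: homogeneous components, constant terms, units -/

section OrderIdeal

open MvPolynomial Literature.RingTheory.MvPolynomial

variable {R : Type*} [CommRing R] {β : Type*}

/-- `p ∈ ⟨x⟩^N` iff all homogeneous components of `p` of degree `< N` vanish (Mathlib's
`MvPolynomial.mem_pow_idealOfVars_iff` in the language of `homogeneousComponent`).
[cite: AtiyahMacdonald1969, Ch. 1 Ex. 1.1 (the ideal (x₁,…,xₙ) and its powers)] -/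
theorem mem_pow_idealOfVars_iff_homogeneousComponent {N : ℕ} {p : MvPolynomial β R} :
    p ∈ idealOfVars β R ^ N ↔ ∀ k < N, homogeneousComponent k p = 0 := by
  rw [mem_pow_idealOfVars_iff]
  constructor
  · intro h k hk
    exact homogeneousComponent_eq_zero' _ _ fun m hm => by
      have := h m hm
      intro hmk
      rw [← hmk] at hk
      exact absurd this (not_le.2 hk)
  · intro h m hm
    by_contra hlt
    push Not at hlt
    have hc := congrArg (coeff m) (h _ hlt)
    rw [coeff_homogeneousComponent, if_pos rfl, coeff_zero] at hc
    exact (mem_support_iff.1 hm) hc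

/-- The constant coefficient of `φ(z)` for `φ ∈ R[x][y]`, `z ∈ R[x]`, is `φ₀(z(0))` where `φ₀` is
`φ` with every coefficient replaced by its constant term. [folklore] -/
private theorem constantCoeff_polynomial_eval (φ : Polynomial (MvPolynomial β R)) (z : MvPolynomial β R) :
    constantCoeff (φ.eval z) =
      (φ.map (constantCoeff : MvPolynomial β R →+* R)).eval (constantCoeff z) :=
  (Polynomial.eval_map_apply (constantCoeff : MvPolynomial β R →+* R) (x := z)).symm

end OrderIdeal

/-! ### §3 The root-free Newton (chord) iteration -/

section Newton

open MvPolynomial Literature.RingTheory.MvPolynomial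

variable {F : Type*} [Field F] {β : Type*}

/-- **Chord iteration keeps the constant term.** With `φ(0, c₀) = 0` (constant term of `φ(C c₀)`
zero) and `ξ = ∂_y φ(0, c₀) ≠ 0`, every iterate `z_r` of `z ↦ z - ξ⁻¹ φ(z)` from `z_0 = C c₀` has
constant term `c₀`, and `φ(z_r)` vanishes to order `r + 1`: `φ(z_r) ∈ ⟨x⟩^{r+1}`.
(Taylor to first order, `Polynomial.binomExpansion`: `φ(z - ξ⁻¹φ(z)) = ξ⁻¹(ξ - φ'(z)) φ(z) +
k ξ⁻² φ(z)²`, and `ξ - φ'(z)` has constant term `0`.)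
[cite: DuttaSaxenaSinhababu2018, §1.3 (slow Newton iteration)]
[cite: DvirShpilkaYehudayoff2009, Lemma 3.1] -/
theorem newton_iterate_constantCoeff_and_eval_mem (φ : Polynomial (MvPolynomial β F)) (c₀ ξ : F)
    (h0 : constantCoeff (φ.eval (C c₀)) = 0)
    (hξ : constantCoeff ((Polynomial.derivative φ).eval (C c₀)) = ξ) (hξ0 : ξ ≠ 0) (r : ℕ) :
    constantCoeff ((fun z => z - C ξ⁻¹ * φ.eval z)^[r] (C c₀)) = c₀ ∧
      φ.eval ((fun z => z - C ξ⁻¹ * φ.eval z)^[r] (C c₀)) ∈ idealOfVars β F ^ (r + 1) := by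
  induction r with
  | zero =>
    refine ⟨by simp, ?_⟩
    rw [Function.iterate_zero_apply, zero_add, pow_one]
    exact (mem_idealOfVars_iff_constantCoeff_eq_zero _).2 h0
  | succ r ih =>
    obtain ⟨ihc, ihm⟩ := ih
    set z := (fun z => z - C ξ⁻¹ * φ.eval z)^[r] (C c₀) with hz
    have hstep : (fun z => z - C ξ⁻¹ * φ.eval z)^[r + 1] (C c₀) = z - C ξ⁻¹ * φ.eval z := by
      rw [Function.iterate_succ_apply', ← hz]
    rw [hstep]
    have hcc0 : constantCoeff (φ.eval z) = 0 :=
      constantCoeff_eq_zero_of_mem_idealOfVars_pow ihm (Nat.succ_ne_zero r)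
    refine ⟨?_, ?_⟩
    · rw [map_sub, map_mul, constantCoeff_C, hcc0, mul_zero, sub_zero, ihc]
    · -- first-order Taylor expansion around `z`
      set e := φ.eval z with he
      set D := (Polynomial.derivative φ).eval z with hD
      obtain ⟨k, hk⟩ := Polynomial.binomExpansion φ z (-(C ξ⁻¹ * e))
      have hsub : z - C ξ⁻¹ * e = z + -(C ξ⁻¹ * e) := sub_eq_add_neg _ _
      have hinv : C ξ⁻¹ * C ξ = (1 : MvPolynomial β F) := by
        rw [← C_mul, inv_mul_cancel₀ hξ0, C_1]
      have hid : φ.eval (z - C ξ⁻¹ * e) =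
          C ξ⁻¹ * ((C ξ - D) * e) + (k * C ξ⁻¹ ^ 2) * (e * e) := by
        rw [hsub, hk, ← he, ← hD]
        linear_combination (-e) * hinv
      -- the constant term of `D` is `ξ`
      have hDcc : constantCoeff D = ξ := by
        rw [hD, constantCoeff_polynomial_eval, ihc, ← constantCoeff_C (σ := β) c₀,
          ← constantCoeff_polynomial_eval, hξ]
      have h1 : C ξ - D ∈ idealOfVars β F :=
        (mem_idealOfVars_iff_constantCoeff_eq_zero _).2
          (by rw [map_sub, constantCoeff_C, hDcc, sub_self])
      have h2 : (C ξ - D) * e ∈ idealOfVars β F ^ (r + 1 + 1) := by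
        rw [pow_succ']
        exact Ideal.mul_mem_mul h1 ihm
      have h3 : e * e ∈ idealOfVars β F ^ (r + 1 + 1) := by
        have h := Ideal.mul_mem_mul ihm ihm
        rw [← pow_add] at h
        exact Ideal.pow_le_pow_right (by omega) h
      rw [hid]
      exact Ideal.add_mem _ (Ideal.mul_mem_left _ _ h2) (Ideal.mul_mem_left _ _ h3)

/-- The constant term of the Newton iterates (first half of
`newton_iterate_constantCoeff_and_eval_mem`). [cite: DuttaSaxenaSinhababu2018, §1.3] -/
theorem newton_iterate_constantCoeff (φ : Polynomial (MvPolynomial β F)) (c₀ ξ : F)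
    (h0 : constantCoeff (φ.eval (C c₀)) = 0)
    (hξ : constantCoeff ((Polynomial.derivative φ).eval (C c₀)) = ξ) (hξ0 : ξ ≠ 0) (r : ℕ) :
    constantCoeff ((fun z => z - C ξ⁻¹ * φ.eval z)^[r] (C c₀)) = c₀ :=
  (newton_iterate_constantCoeff_and_eval_mem φ c₀ ξ h0 hξ hξ0 r).1

/-- **The root-free Newton invariant**: `φ(z_r) ∈ ⟨x⟩^{r+1}` for the `r`-th chord iterate (second
half of `newton_iterate_constantCoeff_and_eval_mem`). [cite: DuttaSaxenaSinhababu2018, §1.3] -/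
theorem newton_iterate_eval_mem (φ : Polynomial (MvPolynomial β F)) (c₀ ξ : F)
    (h0 : constantCoeff (φ.eval (C c₀)) = 0)
    (hξ : constantCoeff ((Polynomial.derivative φ).eval (C c₀)) = ξ) (hξ0 : ξ ≠ 0) (r : ℕ) :
    φ.eval ((fun z => z - C ξ⁻¹ * φ.eval z)^[r] (C c₀)) ∈ idealOfVars β F ^ (r + 1) :=
  (newton_iterate_constantCoeff_and_eval_mem φ c₀ ξ h0 hξ hξ0 r).2

end Newton

/-! ### §4 Vieta's formulas modulo `⟨x⟩^N` from approximate roots -/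

section ApproximateVieta

open Polynomial Literature.RingTheory.MvPolynomial

variable {F : Type*} [Field F] {β : Type*}

/-- **Vieta from approximate roots.** Let `c : Fin n → F[x]` and let `ψ_i ∈ F[x]` (`i < n`) have
pairwise distinct constant terms and satisfy `Q(ψ_i) ∈ ⟨x⟩^N` for the Vieta-form polynomial
`Q = y^n + Σ_j C(c_j) y^{n-1-j}`. Then `c_i ≡ (-1)^{i+1} e_{i+1}(ψ) (mod ⟨x⟩^N)` for every `i`:
in `F[x] ⧸ ⟨x⟩^N` the images of the `ψ_i` are roots of the image of `Q` with unit differences, so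
the factor theorem and Vieta's formulas apply there — the root-free form of the conclusion of the
Newton-iteration step in Bläser–Jindal's proof of Thm. 4.
[cite: BlaserJindal2019, §4 (proof of Thm. 4: Newton iteration for the roots of F(y, e) = yⁿ − e₁yⁿ⁻¹ + ⋯)] -/
theorem sub_esymm_mem_pow_idealOfVars_of_eval_mem {n N : ℕ} (c : Fin n → MvPolynomial β F)
    (ψ : Fin n → MvPolynomial β F)
    (hdist : ∀ i j, i ≠ j → MvPolynomial.constantCoeff (ψ i) ≠ MvPolynomial.constantCoeff (ψ j))
    (heval : ∀ i, (X ^ n + ∑ j : Fin n, C (c j) * X ^ (n - 1 - (j : ℕ))).eval (ψ i) ∈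
      MvPolynomial.idealOfVars β F ^ N) (i : Fin n) :
    c i - (-1) ^ ((i : ℕ) + 1) * ((univ : Finset (Fin n)).val.map ψ).esymm ((i : ℕ) + 1) ∈
      MvPolynomial.idealOfVars β F ^ N := by
  classical
  set I := MvPolynomial.idealOfVars β F ^ N with hI
  set π : MvPolynomial β F →+* MvPolynomial β F ⧸ I := Ideal.Quotient.mk I with hπ
  rcases subsingleton_or_nontrivial (MvPolynomial β F ⧸ I) with hS | hS
  · rw [← Ideal.Quotient.eq_zero_iff_mem]
    exact Subsingleton.elim _ _
  -- the image of `Q` in the quotient, in Vieta form with coefficients `π ∘ c`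
  set Q : (MvPolynomial β F)[X] := X ^ n + ∑ j : Fin n, C (c j) * X ^ (n - 1 - (j : ℕ)) with hQ
  have hQmap : Q.map π = X ^ n + ∑ j : Fin n, C (π (c j)) * X ^ (n - 1 - (j : ℕ)) := by
    rw [hQ, Polynomial.map_add, Polynomial.map_pow, Polynomial.map_X, Polynomial.map_sum]
    congr 1
    refine Finset.sum_congr rfl fun j _ => ?_
    rw [Polynomial.map_mul, Polynomial.map_pow, Polynomial.map_X, Polynomial.map_C]
  have hroot : ∀ j ∈ (univ : Finset (Fin n)), (Q.map π).eval (π (ψ j)) = 0 := by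
    intro j _
    rw [eval_map_apply, Ideal.Quotient.eq_zero_iff_mem]
    exact heval j
  have hunit : ∀ j ∈ (univ : Finset (Fin n)), ∀ j' ∈ (univ : Finset (Fin n)), j ≠ j' →
      IsUnit (π (ψ j) - π (ψ j')) := by
    intro j _ j' _ hjj'
    rw [← map_sub]
    exact isUnit_mk_idealOfVars_pow_of_isUnit_constantCoeff
      (isUnit_iff_ne_zero.2 (by rw [map_sub]; exact sub_ne_zero.2 (hdist j j' hjj'))) N
  have hfac := eq_prod_X_sub_C_of_eval_eq_zero (fun j => π (ψ j)) univ hunit (Q.map π)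
    (by rw [hQmap]; exact monic_X_pow_add_sum_C_mul_X_pow _)
    (by rw [hQmap, natDegree_X_pow_add_sum_C_mul_X_pow, Finset.card_univ, Fintype.card_fin])
    hroot
  rw [prod_X_sub_C_eq_X_pow_add_sum, hQmap] at hfac
  have hcoeff := Polynomial.ext_iff.1 hfac (n - 1 - (i : ℕ))
  rw [coeff_X_pow_add_sum_C_mul_X_pow, coeff_X_pow_add_sum_C_mul_X_pow] at hcoeff
  -- transport `esymm` through `π`
  have hesymm : ((univ : Finset (Fin n)).val.map fun j => π (ψ j)).esymm ((i : ℕ) + 1) =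
      π (((univ : Finset (Fin n)).val.map ψ).esymm ((i : ℕ) + 1)) := by
    rw [← MvPolynomial.aeval_esymm_eq_multiset_esymm (σ := Fin n) (R := F) ((i : ℕ) + 1) ψ,
      ← MvPolynomial.aeval_esymm_eq_multiset_esymm (σ := Fin n) (R := F) ((i : ℕ) + 1)
        (fun j => π (ψ j))]
    exact (MvPolynomial.comp_aeval_apply (f := ψ) (Ideal.Quotient.mkₐ F I) _).symm
  rw [hesymm] at hcoeff
  rw [← Ideal.Quotient.eq_zero_iff_mem, map_sub, sub_eq_zero, map_mul, map_pow, map_neg, map_one]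
  exact hcoeff

end ApproximateVieta

end Literature.Computability.AlgebraicComplexity

end
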